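import Summits.AnomalousDissipation.AnomalousDissipation.Theses.CriticalLayer
import Literature.Analysis.FluidPDE.DoeringFoiasProofs
import Literature.Analysis.FluidPDE.DoeringFoiasPowerProofs
import Literature.Analysis.FluidPDE.StokesTorusProofs
import Literature.Analysis.FluidPDE.OctahedralSymmetry
import Literature.Analysis.FluidPDE.CheskidovAssemblyTools
import Literature.Analysis.FluidPDE.LerayHopfSpectralMeasurability
import Literature.Analysis.FluidPDE.LerayHopfTimeSliceTorus
import Literature.Analysis.FunctionSpaces.TorusEnstrophyOrthogonality
import Literature.Analysis.FunctionSpaces.TorusTestFunction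
import HarnessLib

/-!
# `TurbulentCriticalLayersAbsorb` is the zeroth law in costume (crux-strategist r1 census artefact, stmt-AnomalousDissipation-1011)

Crux `C := CriticalLayer.TurbulentCriticalLayersAbsorb` (route CriticalLayer, rank 2): there are `F G k m`, viscosities `ν_j → 0`
and a bounded-energy global Leray–Hopf family for the two-mode force `f_{F,G,k,m} = F sin(2πk x₂) e₁ + G sin(2πm x₁) e₂`
whose limsup-mean OBLIQUE injection `⟨(g_{G,m}, u_j)⟩` has a `ν`-uniform floor `ε > 0`.

## Part 1 (hypothesis-free) — the dominating hypothesis of tribunal rule T1(a)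

`KolmogorovZerothLaw` (`H₀`) := the summit statement `Literature.Turb.ZerothLaw` RESTRICTED to the single-mode Kolmogorov force
`g_{G,m} = G sin(2πm x₁) e₂` (the `F = 0` member of the route's own force class; the textbook DNS instance of the zeroth law,
Musacchio–Boffetta 2014 = arXiv:1401.5935 §2: `ε = ⟨u·f⟩ = ½FU`, friction factor `→ const`).  We prove

* `kolmogorovZerothLaw_implies_summit : KolmogorovZerothLaw → AnomalousDissipation` (specialisation of `∃ f`), and
* `kolmogorovZerothLaw_implies_crux   : KolmogorovZerothLaw → TurbulentCriticalLayersAbsorb`: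
  the Leray–Hopf energy inequality in the mean, `meanDissipation ≤ meanPower` (tree theorem
  `DoeringFoias2002_dissipation_le_power_holds`), turns the dissipation floor into a floor on the TOTAL injected power, which for
  `F = 0` is the oblique injection; take `F = 0`, `k = 1`.

So `C` is implied by a hypothesis `H₀` that is itself an instance of the summit `S` (`H₀ ⇒ S` trivially): rule T1(a) with a
kernel-checked `H₀ ⇒ C`.  `C` is weaker than `H₀` only by (no Leray–Hopf leakage in the mean) and (the shear channel is not an
`O(1)` brake) — exactly the two ∀-cruxes `NoMeanLeakage`, `ShearInjectionSign` that the route's glue re-imposes to climb back to `S`.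

## Part 2 (modulo ONE folklore symmetry, stated as a hypothesis like the route's own `LerayHopfSpaceTranslation`)

`LerayHopfTransposeCovariance` := torus Leray–Hopf solutions are covariant under the lattice isometry
`(x₁,x₂,x₃) ↦ (x₂,x₁,x₃)` acting on positions and velocity components.  Under it:

* `zerothLawTwoMode_implies_crux : LerayHopfTransposeCovariance → ZerothLawTwoMode → TurbulentCriticalLayersAbsorb`, where
  `ZerothLawTwoMode` is `S` restricted to the route's WHOLE force class `f_{F,G,k,m}` (dissipation floor ⇒ total-injection floor ⇒
  for each `j` one channel carries `ε/2` ⇒ pigeonhole over `j` + subsequence; if the shear channel wins, transpose: the shear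
  channel of `f_{F,G,k,m}` is the oblique channel of `f_{G,F,m,k}`);
* `saturatedKolmogorovFamily_implies_crux : LerayHopfTransposeCovariance → SaturatedKolmogorovFamily → TurbulentCriticalLayersAbsorb`,
  where `SaturatedKolmogorovFamily` is VERBATIM the statement of `stub_saturatedKolmogorovFamily` of the registered birth
  skeleton `Cruxes/KolmogorovObliqueThesis/Lines/BirthTurbulentCriticalLayersAbsorb.lean`: that piece gives the crux ON ITS OWN
  (it is `C` for the transposed force, with a `liminf` floor), so the registered two-stub split is not an honest decomposition.

References: C. R. Doering, C. Foias, J. Fluid Mech. 467 (2002) §2; A. Cheskidov, C. Doering, N. Petrov, JFM 2007 eq. (11)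
(`ε ≤ ⟨f·u⟩` for Leray–Hopf solutions); S. Musacchio, G. Boffetta, Phys. Rev. E 89 (2014) = arXiv:1401.5935 §2; U. Frisch,
*Turbulence* (1995) §2.2 (symmetries of NSE in the periodic box), §5.2; E. Bruè, C. De Lellis, CMP 2023 = arXiv:2207.06301 §1–2.
-/

set_option linter.dupNamespace false

noncomputable section

open MeasureTheory Filter Set Topology Function
open scoped InnerProductSpace RealInnerProductSpace ENNReal NNReal
open Literature.Analysis.FunctionSpaces Literature.Analysis.FunctionSpaces.Torus
open Literature.Analysis.FluidPDE Literature.Analysis.FluidPDE.Torus UnitAddTorus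
open Summit.AnomalousDissipation.AnomalousDissipation.Theses

namespace Summit.AnomalousDissipation.AnomalousDissipation.Cruxes.TurbulentCriticalLayersAbsorb

local notation "𝕋³" => UnitAddTorus (Fin 3)
local notation "E³" => EuclideanSpace ℝ (Fin 3)

/-! ## Part 1: the single-mode Kolmogorov zeroth law dominates the crux -/

/-- The single-mode Kolmogorov force `g_{G,m}(x) = G sin(2πm x₁) e₂`, written exactly as the oblique summand of the route's
force `f_{F,G,k,m}`. -/
def kolmogorovForce (G : ℝ) (m : ℕ) : 𝕋³ → E³ :=
  fun x : 𝕋³ => (G * (UnitAddTorus.mFourier (Pi.single (0 : Fin 3) (m : ℤ)) x).im) • (EuclideanSpace.single (1 : Fin 3) (1 : ℝ) : E³)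

/-- `g_{G,m}` is the sine Stokes mode with frequency `m e₁` and amplitude `G e₂`. -/
theorem kolmogorovForce_eq_stokesMode (G : ℝ) (m : ℕ) :
    kolmogorovForce G m = ⇑(stokesMode (Pi.single (0 : Fin 3) (m : ℤ)) (G • EuclideanSpace.single (1 : Fin 3) (1 : ℝ)) false) := by
  funext x
  simp only [kolmogorovForce, stokesMode_apply, Bool.false_eq_true, if_false, smul_smul, mul_comm G]

/-- `g_{G,m}` is smooth. -/
theorem isSmooth_kolmogorovForce (G : ℝ) (m : ℕ) : IsSmooth (kolmogorovForce G m) := by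
  rw [kolmogorovForce_eq_stokesMode]
  exact isSmooth_stokesMode _ _ false

/-- `g_{G,m}` is divergence free (the amplitude `e₂` is transversal to the frequency `m e₁`). -/
theorem isDivFree_kolmogorovForce (G : ℝ) (m : ℕ) : IsDivFree (kolmogorovForce G m) := by
  rw [kolmogorovForce_eq_stokesMode]
  refine isDivFree_stokesMode ?_ false
  rw [← sum_intCast_mul_eq_inner_latticeVec, Fin.sum_univ_three]
  simp

/-- `g_{G,m}` has zero mean (also for `m = 0`, when it vanishes). -/
theorem hasZeroMean_kolmogorovForce (G : ℝ) (m : ℕ) : HasZeroMean (kolmogorovForce G m) := by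
  by_cases hm : m = 0
  · subst hm
    unfold HasZeroMean
    have h0 : ∀ x : 𝕋³, kolmogorovForce G 0 x = 0 := fun x => by
      simp [kolmogorovForce, mFourier_zero]
    simp_rw [h0, integral_zero]
  · rw [kolmogorovForce_eq_stokesMode]
    refine hasZeroMean_stokesMode (fun h => hm ?_) _ false
    have := congrFun h 0
    simpa using this

/-- With `F = 0` the route's two-mode force IS the single-mode Kolmogorov force (pointwise). -/
theorem criticalLayerForce_zero_left (G : ℝ) (k m : ℕ) (x : 𝕋³) :
    ((0 : ℝ) * (UnitAddTorus.mFourier (Pi.single (1 : Fin 3) (k : ℤ)) x).im) • (EuclideanSpace.single (0 : Fin 3) (1 : ℝ) : E³) +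
      (G * (UnitAddTorus.mFourier (Pi.single (0 : Fin 3) (m : ℤ)) x).im) • (EuclideanSpace.single (1 : Fin 3) (1 : ℝ) : E³) =
    kolmogorovForce G m x := by
  simp [kolmogorovForce]

/-- **`H₀`, the zeroth law for single-mode Kolmogorov forcing**: the summit statement `Literature.Turb.ZerothLaw` with its force
restricted to `g_{G,m} = G sin(2πm x₁) e₂` (`m ≥ 1`): viscosities `ν_j → 0`, a bounded-energy global Leray–Hopf family driven by
`g_{G,m}`, mean dissipation bounded below.  (Musacchio–Boffetta 2014 §2: for this forcing `ε = ⟨u·f⟩ = ½ F U` and the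
friction factor tending to a positive constant "corresponds to the so-called zeroth law of turbulence".) -/
def KolmogorovZerothLaw : Prop :=
  ∃ (G : ℝ) (m : ℕ) (ν : ℕ → ℝ) (u₀ : ℕ → 𝕋³ → E³) (u : ℕ → ℝ → 𝕋³ → E³), 0 < m ∧ (∀ j, 0 < ν j) ∧
    Filter.Tendsto ν Filter.atTop (nhds 0) ∧ (∀ j, IsGlobalLerayHopf (ν j) (fun _ => kolmogorovForce G m) (u₀ j) (u j)) ∧
    (∃ E : ℝ, ∀ j, meanEnergy (u j) ≤ E) ∧ ∃ ε : ℝ, 0 < ε ∧ ∀ j, ε ≤ meanDissipation (ν j) (u j)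

/-- `H₀ ⇒ S`: the single-mode Kolmogorov zeroth law is an instance of the summit statement. -/
theorem kolmogorovZerothLaw_implies_summit (h : KolmogorovZerothLaw) : AnomalousDissipation := by
  obtain ⟨G, m, ν, u₀, u, -, hν, hν0, hLH, hE, ε, hε, hfloor⟩ := h
  exact ⟨kolmogorovForce G m, isSmooth_kolmogorovForce G m, isDivFree_kolmogorovForce G m, hasZeroMean_kolmogorovForce G m,
    ν, u₀, u, hν, hν0, hLH, hE, ε, hε, hfloor⟩

/-- The Leray–Hopf energy inequality in the mean for the Kolmogorov force: mean dissipation ≤ mean injected power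
(`DoeringFoias2002_dissipation_le_power_holds`). -/
theorem meanDissipation_le_obliquePower {G : ℝ} {m : ℕ} {ν : ℝ} (hν : 0 < ν) {u₀ : 𝕋³ → E³} {u : ℝ → 𝕋³ → E³}
    (hu : IsGlobalLerayHopf ν (fun _ => kolmogorovForce G m) u₀ u) :
    meanDissipation ν u ≤ longTimeAvgSup (fun t => ∫ x, ⟪kolmogorovForce G m x, u t x⟫) :=
  DoeringFoias2002_dissipation_le_power_holds hν ((isSmooth_kolmogorovForce G m).memLp 2) (hasZeroMean_kolmogorovForce G m) u₀ u hu

/-- **`H₀ ⇒ C` (the costume theorem).**  The single-mode Kolmogorov zeroth law implies the crux `TurbulentCriticalLayersAbsorb`: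
take `F = 0`, `k = 1`; the force is then `g_{G,m}` itself, and the dissipation floor `ε` is a floor on the total injected power
(`meanDissipation ≤ meanPower`), which for `F = 0` is the oblique injection. -/
theorem kolmogorovZerothLaw_implies_crux (h : KolmogorovZerothLaw) : CriticalLayer.TurbulentCriticalLayersAbsorb := by
  obtain ⟨G, m, ν, u₀, u, hm, hν, hν0, hLH, hE, ε, hε, hfloor⟩ := h
  have hforce : (fun _ : ℝ => fun x : 𝕋³ =>
      ((0 : ℝ) * (UnitAddTorus.mFourier (Pi.single (1 : Fin 3) ((1 : ℕ) : ℤ)) x).im) • (EuclideanSpace.single (0 : Fin 3) (1 : ℝ) : E³) +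
        (G * (UnitAddTorus.mFourier (Pi.single (0 : Fin 3) (m : ℤ)) x).im) • (EuclideanSpace.single (1 : Fin 3) (1 : ℝ) : E³)) =
      fun _ : ℝ => kolmogorovForce G m := by
    funext t x
    exact criticalLayerForce_zero_left G 1 m x
  refine ⟨0, G, 1, m, ν, u₀, u, Nat.one_pos, hm, hν, hν0, ?_, hE, ε, hε, fun j => ?_⟩
  · intro j
    rw [hforce]
    exact hLH j
  · exact (hfloor j).trans (meanDissipation_le_obliquePower (hν j) (hLH j))



/-! ## Part 2a: the lattice transposition `(x₁,x₂,x₃) ↦ (x₂,x₁,x₃)` -/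

section Transpose

/-- The transposition of positions `σ (x₁,x₂,x₃) = (x₂,x₁,x₃)` (a lattice isometry of `T³`). -/
def trPos (x : 𝕋³) : 𝕋³ := fun i => x (Equiv.swap (0 : Fin 3) 1 i)

/-- The transposition of velocity components `(v₁,v₂,v₃) ↦ (v₂,v₁,v₃)` (the linear isometry `swapReflection 0 1`). -/
def trVec (v : E³) : E³ := swapReflection (0 : Fin 3) 1 v

/-- The transposed vector field `(𝒯v)(x) = P v(σx)`. -/
def trField (v : 𝕋³ → E³) : 𝕋³ → E³ := fun x => trVec (v (trPos x))

theorem trPos_trPos (x : 𝕋³) : trPos (trPos x) = x := by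
  funext i
  simp [trPos, Equiv.swap_apply_self]

@[simp] theorem trVec_apply (v : E³) (j : Fin 3) : trVec v j = v (Equiv.swap (0 : Fin 3) 1 j) :=
  swapReflection_apply 0 1 v j

theorem trVec_trVec (v : E³) : trVec (trVec v) = v := by
  ext j
  simp [Equiv.swap_apply_self]

theorem trField_trField (v : 𝕋³ → E³) : trField (trField v) = v := by
  funext x
  simp only [trField, trPos_trPos, trVec_trVec]

theorem trVec_add (v w : E³) : trVec (v + w) = trVec v + trVec w := map_add _ _ _

theorem trVec_smul (c : ℝ) (v : E³) : trVec (c • v) = c • trVec v := map_smul _ _ _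

theorem norm_trVec (v : E³) : ‖trVec v‖ = ‖v‖ := LinearIsometryEquiv.norm_map _ _

/-- `P` is a symmetric involution: `⟪a, P b⟫ = ⟪P a, b⟫`. -/
theorem inner_trVec_right (a b : E³) : ⟪a, trVec b⟫ = ⟪trVec a, b⟫ := by
  have h := LinearIsometryEquiv.inner_map_map (swapReflection (0 : Fin 3) 1) (trVec a) b
  -- `⟪P (P a), P b⟫ = ⟪P a, b⟫` and `P (P a) = a`
  have e : swapReflection (0 : Fin 3) 1 (trVec a) = a := trVec_trVec a
  rw [e] at h
  exact h

/-- `swap 0 1` fixes the third axis. -/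
@[simp] theorem swap01_two : Equiv.swap (0 : Fin 3) 1 2 = 2 := Equiv.swap_apply_of_ne_of_ne (by decide) (by decide)

theorem trVec_single_zero : trVec (EuclideanSpace.single (0 : Fin 3) (1 : ℝ)) = EuclideanSpace.single (1 : Fin 3) (1 : ℝ) := by
  ext j
  fin_cases j <;> simp

theorem trVec_single_one : trVec (EuclideanSpace.single (1 : Fin 3) (1 : ℝ)) = EuclideanSpace.single (0 : Fin 3) (1 : ℝ) := by
  ext j
  fin_cases j <;> simp

/-- The character `e^{2πi n x₂}` at the transposed point is `e^{2πi n x₁}`. -/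
theorem mFourier_single_one_trPos (n : ℤ) (x : 𝕋³) :
    mFourier (Pi.single (1 : Fin 3) n) (trPos x) = mFourier (Pi.single (0 : Fin 3) n) x := by
  simp [mFourier, Fin.prod_univ_three, trPos, Pi.single_apply]

/-- The character `e^{2πi n x₁}` at the transposed point is `e^{2πi n x₂}`. -/
theorem mFourier_single_zero_trPos (n : ℤ) (x : 𝕋³) :
    mFourier (Pi.single (0 : Fin 3) n) (trPos x) = mFourier (Pi.single (1 : Fin 3) n) x := by
  simp [mFourier, Fin.prod_univ_three, trPos, Pi.single_apply]

/-- **The transposed two-mode force**: `𝒯 f_{F,G,k,m} = f_{G,F,m,k}` — the shear part of one is the oblique part of the other. -/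
theorem trField_criticalLayerForce (F G : ℝ) (k m : ℕ) :
    trField (fun x : 𝕋³ => (F * (UnitAddTorus.mFourier (Pi.single (1 : Fin 3) (k : ℤ)) x).im) • (EuclideanSpace.single (0 : Fin 3) (1 : ℝ) : E³) +
        (G * (UnitAddTorus.mFourier (Pi.single (0 : Fin 3) (m : ℤ)) x).im) • (EuclideanSpace.single (1 : Fin 3) (1 : ℝ) : E³)) =
      fun x : 𝕋³ => (G * (UnitAddTorus.mFourier (Pi.single (1 : Fin 3) (m : ℤ)) x).im) • (EuclideanSpace.single (0 : Fin 3) (1 : ℝ) : E³) +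
        (F * (UnitAddTorus.mFourier (Pi.single (0 : Fin 3) (k : ℤ)) x).im) • (EuclideanSpace.single (1 : Fin 3) (1 : ℝ) : E³) := by
  funext x
  simp only [trField, trVec_add, trVec_smul, trVec_single_zero, trVec_single_one, mFourier_single_one_trPos,
    mFourier_single_zero_trPos]
  exact add_comm _ _

/-- The transposed OBLIQUE test field is the SHEAR test field with the same amplitude and wavenumber. -/
theorem trField_obliqueForce (F : ℝ) (k : ℕ) :
    trField (fun x : 𝕋³ => (F * (UnitAddTorus.mFourier (Pi.single (0 : Fin 3) (k : ℤ)) x).im) • (EuclideanSpace.single (1 : Fin 3) (1 : ℝ) : E³)) =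
      fun x : 𝕋³ => (F * (UnitAddTorus.mFourier (Pi.single (1 : Fin 3) (k : ℤ)) x).im) • (EuclideanSpace.single (0 : Fin 3) (1 : ℝ) : E³) := by
  funext x
  simp only [trField, trVec_smul, trVec_single_one, mFourier_single_zero_trPos]

/-- **`σ` preserves the Haar measure** (a relabelling of the factors of the product measure): `∫ g(σx) dx = ∫ g(x) dx`. -/
theorem integral_comp_trPos {F' : Type*} [NormedAddCommGroup F'] [NormedSpace ℝ F'] (g : 𝕋³ → F') :
    ∫ x, g (trPos x) = ∫ x, g x := by
  have h : MeasurePreserving (MeasurableEquiv.piCongrLeft (fun _ : Fin 3 => UnitAddCircle) (Equiv.swap (0 : Fin 3) 1))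
      (volume : Measure 𝕋³) (volume : Measure 𝕋³) :=
    volume_measurePreserving_piCongrLeft (fun _ : Fin 3 => UnitAddCircle) (Equiv.swap (0 : Fin 3) 1)
  rw [← h.integral_comp']
  refine integral_congr_ae (Eventually.of_forall fun x => ?_)
  show g _ = g _
  congr 1
  funext i
  simp only [MeasurableEquiv.coe_piCongrLeft, Equiv.piCongrLeft_apply_eq_cast, cast_eq, Equiv.symm_swap, trPos,
    Equiv.swap_apply_self]

/-- Transposition moves from the velocity to the test field inside the pairing: `∫⟪φ, 𝒯v⟫ = ∫⟪𝒯φ, v⟫`. -/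
theorem integral_inner_trField (φ v : 𝕋³ → E³) : ∫ x, ⟪φ x, trField v x⟫ = ∫ x, ⟪trField φ x, v x⟫ := by
  have h := integral_comp_trPos (fun y => ⟪trField φ y, v y⟫)
  rw [← h]
  refine integral_congr_ae (Eventually.of_forall fun x => ?_)
  show ⟪φ x, trVec (v (trPos x))⟫ = ⟪trVec (φ (trPos (trPos x))), v (trPos x)⟫
  rw [trPos_trPos, inner_trVec_right]

/-- Kinetic `L²` mass is transposition invariant. -/
theorem integral_norm_sq_trField (v : 𝕋³ → E³) : ∫ x, ‖trField v x‖ ^ 2 = ∫ x, ‖v x‖ ^ 2 := by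
  have h := integral_comp_trPos (fun y => ‖v y‖ ^ 2)
  rw [← h]
  refine integral_congr_ae (Eventually.of_forall fun x => ?_)
  show ‖trVec (v (trPos x))‖ ^ 2 = ‖v (trPos x)‖ ^ 2
  rw [norm_trVec]

/-- Mean energy is transposition invariant. -/
theorem meanEnergy_trField (u : ℝ → 𝕋³ → E³) : meanEnergy (fun t => trField (u t)) = meanEnergy u := by
  simp only [meanEnergy, meanSqVelocity]
  congr 1
  funext t
  exact integral_norm_sq_trField (u t)

/-- **Transposition covariance of torus Leray–Hopf solutions** (folklore symmetry of the Navier–Stokes equations in the periodic box,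
Frisch 1995 §2.2; the transposition is an element of the hyperoctahedral lattice symmetry group; stated as a named hypothesis exactly like
the route's own support item `CriticalLayer.LerayHopfSpaceTranslation`, and provable field by field in the same way). -/
def LerayHopfTransposeCovariance : Prop :=
  ∀ (T ν : ℝ) (f : ℝ → 𝕋³ → E³) (u₀ : 𝕋³ → E³) (u : ℝ → 𝕋³ → E³),
    IsLerayHopfOn T ν f u₀ u → IsLerayHopfOn T ν (fun t => trField (f t)) (trField u₀) (fun t => trField (u t))

theorem isGlobalLerayHopf_trField (hT : LerayHopfTransposeCovariance) {ν : ℝ} {f : ℝ → 𝕋³ → E³} {u₀ : 𝕋³ → E³} {u : ℝ → 𝕋³ → E³}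
    (h : IsGlobalLerayHopf ν f u₀ u) : IsGlobalLerayHopf ν (fun t => trField (f t)) (trField u₀) (fun t => trField (u t)) :=
  fun T hT' => hT T ν f u₀ u (h T hT')

end Transpose

/-! ## Part 2b: channel bookkeeping for the two-mode force -/

section Channels

/-- The shear test field / force component `s_{F,k}(x) = F sin(2πk x₂) e₁`, written as in the route file. -/
def shearField (F : ℝ) (k : ℕ) : 𝕋³ → E³ :=
  fun x : 𝕋³ => (F * (UnitAddTorus.mFourier (Pi.single (1 : Fin 3) (k : ℤ)) x).im) • (EuclideanSpace.single (0 : Fin 3) (1 : ℝ) : E³)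

/-- The oblique test field / force component `g_{G,m}(x) = G sin(2πm x₁) e₂`, written as in the route file. -/
def obliqueField (G : ℝ) (m : ℕ) : 𝕋³ → E³ :=
  fun x : 𝕋³ => (G * (UnitAddTorus.mFourier (Pi.single (0 : Fin 3) (m : ℤ)) x).im) • (EuclideanSpace.single (1 : Fin 3) (1 : ℝ) : E³)

/-- The route's two-mode force `f_{F,G,k,m} = s_{F,k} + g_{G,m}` (definitionally the lambda in the route file). -/
def twoModeForce (F G : ℝ) (k m : ℕ) : 𝕋³ → E³ :=
  fun x : 𝕋³ => (F * (UnitAddTorus.mFourier (Pi.single (1 : Fin 3) (k : ℤ)) x).im) • (EuclideanSpace.single (0 : Fin 3) (1 : ℝ) : E³) +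
    (G * (UnitAddTorus.mFourier (Pi.single (0 : Fin 3) (m : ℤ)) x).im) • (EuclideanSpace.single (1 : Fin 3) (1 : ℝ) : E³)

theorem twoModeForce_apply (F G : ℝ) (k m : ℕ) (x : 𝕋³) : twoModeForce F G k m x = shearField F k x + obliqueField G m x := rfl

/-- The oblique field is the single-mode Kolmogorov force of Part 1 (definitional). -/
theorem obliqueField_eq_kolmogorovForce (G : ℝ) (m : ℕ) : obliqueField G m = kolmogorovForce G m := rfl

theorem shearField_eq_stokesMode (F : ℝ) (k : ℕ) :
    shearField F k = ⇑(stokesMode (Pi.single (1 : Fin 3) (k : ℤ)) (F • EuclideanSpace.single (0 : Fin 3) (1 : ℝ)) false) := by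
  funext x
  simp only [shearField, stokesMode_apply, Bool.false_eq_true, if_false, smul_smul, mul_comm F]

theorem obliqueField_eq_stokesMode (G : ℝ) (m : ℕ) :
    obliqueField G m = ⇑(stokesMode (Pi.single (0 : Fin 3) (m : ℤ)) (G • EuclideanSpace.single (1 : Fin 3) (1 : ℝ)) false) := by
  funext x
  simp only [obliqueField, stokesMode_apply, Bool.false_eq_true, if_false, smul_smul, mul_comm G]

theorem isSmooth_shearField (F : ℝ) (k : ℕ) : IsSmooth (shearField F k) := by
  rw [shearField_eq_stokesMode]; exact isSmooth_stokesMode _ _ false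

theorem isSmooth_obliqueField (G : ℝ) (m : ℕ) : IsSmooth (obliqueField G m) := by
  rw [obliqueField_eq_stokesMode]; exact isSmooth_stokesMode _ _ false

/-- A sine Stokes mode at an axis frequency `n eᵢ`, `n : ℕ`, has zero mean (also for `n = 0`, when it vanishes). -/
theorem hasZeroMean_stokesMode_single_nat (i : Fin 3) (n : ℕ) (a : E³) :
    HasZeroMean ⇑(stokesMode (Pi.single i (n : ℤ)) a false) := by
  by_cases hn : n = 0
  · subst hn
    unfold HasZeroMean
    have h0 : ∀ x : 𝕋³, stokesMode (Pi.single i ((0 : ℕ) : ℤ)) a false x = 0 := fun x => by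
      rw [stokesMode_apply, Nat.cast_zero, Pi.single_zero, mFourier_zero]
      simp
    simp_rw [h0, integral_zero]
  · refine hasZeroMean_stokesMode (fun h => hn ?_) a false
    have := congrFun h i
    simpa using this

/-- Sums of smooth divergence-free fields on `T³` are divergence free. -/
theorem isDivFree_add_of_isSmooth {f g : 𝕋³ → E³} (hf : IsSmooth f) (hg : IsSmooth g) (hdf : IsDivFree f) (hdg : IsDivFree g) :
    IsDivFree (f + g) := by
  intro x
  have h1 : IsContDiff 1 f := hf.isContDiff (by simp)
  have h2 : IsContDiff 1 g := hg.isContDiff (by simp)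
  have ef := hdf x
  have eg := hdg x
  rw [divergence_eq_sum_partialDeriv_apply h1] at ef
  rw [divergence_eq_sum_partialDeriv_apply h2] at eg
  rw [divergence_eq_sum_partialDeriv_apply (h1.add h2)]
  simp only [partialDeriv_add h1 h2, Pi.add_apply, PiLp.add_apply, Finset.sum_add_distrib, ef, eg, add_zero]

/-- **Regularity of the two-mode force** (the route's support item `KolmogorovObliqueForceRegular`, re-proved here to stay
self-contained): smooth, divergence free, mean zero, for all `F, G, k, m`. -/
theorem twoModeForce_regular (F G : ℝ) (k m : ℕ) :
    IsSmooth (twoModeForce F G k m) ∧ IsDivFree (twoModeForce F G k m) ∧ HasZeroMean (twoModeForce F G k m) := by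
  have e : twoModeForce F G k m = shearField F k + obliqueField G m := rfl
  rw [e, shearField_eq_stokesMode, obliqueField_eq_stokesMode]
  have hs₁ := isSmooth_stokesMode (Pi.single (1 : Fin 3) (k : ℤ)) (F • EuclideanSpace.single (0 : Fin 3) (1 : ℝ)) false
  have hs₂ := isSmooth_stokesMode (Pi.single (0 : Fin 3) (m : ℤ)) (G • EuclideanSpace.single (1 : Fin 3) (1 : ℝ)) false
  have ht₁ : ⟪latticeVec (Pi.single (1 : Fin 3) (k : ℤ)), F • EuclideanSpace.single (0 : Fin 3) (1 : ℝ)⟫ = 0 := by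
    rw [← sum_intCast_mul_eq_inner_latticeVec, Fin.sum_univ_three]
    simp
  have ht₂ : ⟪latticeVec (Pi.single (0 : Fin 3) (m : ℤ)), G • EuclideanSpace.single (1 : Fin 3) (1 : ℝ)⟫ = 0 := by
    rw [← sum_intCast_mul_eq_inner_latticeVec, Fin.sum_univ_three]
    simp
  refine ⟨hs₁.add hs₂, isDivFree_add_of_isSmooth hs₁ hs₂ (isDivFree_stokesMode ht₁ false) (isDivFree_stokesMode ht₂ false), ?_⟩
  unfold HasZeroMean
  rw [integral_add' hs₁.integrable hs₂.integrable]
  rw [show (∫ x, stokesMode (Pi.single (1 : Fin 3) (k : ℤ)) (F • EuclideanSpace.single (0 : Fin 3) (1 : ℝ)) false x) = 0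
      from hasZeroMean_stokesMode_single_nat 1 k _,
    show (∫ x, stokesMode (Pi.single (0 : Fin 3) (m : ℤ)) (G • EuclideanSpace.single (1 : Fin 3) (1 : ℝ)) false x) = 0
      from hasZeroMean_stokesMode_single_nat 0 m _, add_zero]

/-- The transposed two-mode force: `𝒯 f_{F,G,k,m} = f_{G,F,m,k}`. -/
theorem trField_twoModeForce (F G : ℝ) (k m : ℕ) : trField (twoModeForce F G k m) = twoModeForce G F m k :=
  trField_criticalLayerForce F G k m

/-- The transposed oblique field is the shear field: `𝒯 g_{F,k} = s_{F,k}`. -/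
theorem trField_obliqueField (F : ℝ) (k : ℕ) : trField (obliqueField F k) = shearField F k :=
  trField_obliqueForce F k

/-- The shear-mode amplitude `∫ sin(2πk x₂) v₁` (the quantity floored in `stub_saturatedKolmogorovFamily`). -/
def shearAmp (k : ℕ) (v : 𝕋³ → E³) : ℝ := ∫ x, (UnitAddTorus.mFourier (Pi.single (1 : Fin 3) (k : ℤ)) x).im * v x 0

/-- The shear pairing is `F` times the shear-mode amplitude: `∫⟪s_{F,k}, v⟫ = F ∫ sin(2πk x₂) v₁`. -/
theorem integral_inner_shearField (F : ℝ) (k : ℕ) (v : 𝕋³ → E³) : ∫ x, ⟪shearField F k x, v x⟫ = F * shearAmp k v := by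
  unfold shearAmp
  rw [← integral_const_mul]
  refine integral_congr_ae (ae_of_all _ fun x => ?_)
  simp only [shearField, real_inner_smul_left, EuclideanSpace.inner_single_left, map_one, one_mul, mul_assoc]

/-- **The oblique pairing of a transposed field is the shear pairing of the field** (same amplitude and wavenumber). -/
theorem integral_inner_obliqueField_trField (F : ℝ) (k : ℕ) (v : 𝕋³ → E³) :
    ∫ x, ⟪obliqueField F k x, trField v x⟫ = ∫ x, ⟪shearField F k x, v x⟫ := by
  rw [integral_inner_trField, trField_obliqueField]

end Channels

/-! ## Part 2c: bounded Cesàro means of smooth pairings along Leray–Hopf solutions -/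

section Means

variable {ν : ℝ} {f φ : 𝕋³ → E³} {u₀ : 𝕋³ → E³} {u : ℝ → 𝕋³ → E³}

/-- Pairings of `L²` fields are integrable. -/
theorem integrable_inner_of_memLp' {a w : 𝕋³ → E³} (ha : MemLp a 2 volume) (hw : MemLp w 2 volume) :
    Integrable (fun x => ⟪a x, w x⟫) volume :=
  (ha.norm.integrable_mul hw.norm).mono' (ha.aestronglyMeasurable.inner hw.aestronglyMeasurable)
    (ae_of_all _ fun x => norm_inner_le_norm (a x) (w x))

/-- AM–GM form of Cauchy–Schwarz for a pairing along a Leray–Hopf solution: `|∫⟪φ, u(t)⟫| ≤ (‖φ‖₂² + ‖u(t)‖₂²)/2`. -/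
theorem abs_pairing_le (hφ : IsSmooth φ) (hu : IsGlobalLerayHopf ν (fun _ => f) u₀ u) {t : ℝ} (ht : 0 ≤ t) :
    |∫ x, ⟪φ x, u t x⟫| ≤ ((∫ x, ‖φ x‖ ^ 2) + ∫ x, ‖u t x‖ ^ 2) / 2 := by
  have h := abs_integral_inner_le_sqrt_mul_sqrt (hφ.memLp 2) (hu.memLp_two ht)
  refine h.trans ?_
  have ha : 0 ≤ ∫ x, ‖φ x‖ ^ 2 := integral_nonneg fun _ => sq_nonneg _
  have hb : 0 ≤ ∫ x, ‖u t x‖ ^ 2 := integral_nonneg fun _ => sq_nonneg _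
  nlinarith [sq_nonneg (Real.sqrt (∫ x, ‖φ x‖ ^ 2) - Real.sqrt (∫ x, ‖u t x‖ ^ 2)), Real.sq_sqrt ha, Real.sq_sqrt hb]

/-- The pairing `t ↦ ∫⟪φ, u(t)⟫` is interval integrable on `[0, T]`. -/
theorem intervalIntegrable_pairing (hφ : IsSmooth φ) (hu : IsGlobalLerayHopf ν (fun _ => f) u₀ u) {T : ℝ} (hT : 0 < T) :
    IntervalIntegrable (fun t => ∫ x, ⟪φ x, u t x⟫) volume 0 T := by
  have h1 : IntegrableOn (fun s => ∫ x, ⟪u s x, φ x⟫) (Ioo 0 T) := (hu T hT).integrableOn_integral_inner hφ.continuous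
  have h2 : (fun t => ∫ x, ⟪φ x, u t x⟫) = fun s => ∫ x, ⟪u s x, φ x⟫ := by
    funext s
    exact integral_congr_ae (ae_of_all _ fun x => real_inner_comm _ _)
  rw [intervalIntegrable_iff_integrableOn_Ioc_of_le hT.le, h2]
  exact (integrableOn_Ioc_iff_integrableOn_Ioo).mpr h1

/-- Bound on the Cesàro means of a pairing: for `T > 0`, `|T⁻¹∫₀ᵀ ∫⟪φ, u⟫| ≤ (‖φ‖₂² + T⁻¹∫₀ᵀ‖u‖₂²)/2`. -/
theorem abs_timeMean_pairing_le (hφ : IsSmooth φ) (hu : IsGlobalLerayHopf ν (fun _ => f) u₀ u) {T : ℝ} (hT : 0 < T) :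
    |timeMean (fun t => ∫ x, ⟪φ x, u t x⟫) T| ≤ ((∫ x, ‖φ x‖ ^ 2) + timeMean (fun t => ∫ x, ‖u t x‖ ^ 2) T) / 2 := by
  set E : ℝ → ℝ := fun τ => ∫ x, ‖u τ x‖ ^ 2 with hEdef
  set P : ℝ → ℝ := fun τ => ∫ x, ⟪φ x, u τ x⟫ with hPdef
  set A : ℝ := ∫ x, ‖φ x‖ ^ 2 with hA
  have hEint : IntervalIntegrable E volume 0 T :=
    (intervalIntegrable_iff_integrableOn_Ioc_of_le hT.le).2 (hu.integrableOn_integral_norm_sq hT)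
  have hPint : IntervalIntegrable P volume 0 T := intervalIntegrable_pairing hφ hu hT
  have hmono : ∫ τ in (0 : ℝ)..T, |P τ| ≤ ∫ τ in (0 : ℝ)..T, (A + E τ) / 2 := by
    refine intervalIntegral.integral_mono_on hT.le hPint.abs ((_root_.intervalIntegrable_const.add hEint).div_const 2)
      fun τ hτ => ?_
    exact abs_pairing_le hφ hu hτ.1
  have habs : |∫ τ in (0 : ℝ)..T, P τ| ≤ ∫ τ in (0 : ℝ)..T, |P τ| := intervalIntegral.abs_integral_le_integral_abs hT.le
  rw [intervalIntegral.integral_div, intervalIntegral.integral_add _root_.intervalIntegrable_const hEint,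
    intervalIntegral.integral_const, sub_zero, smul_eq_mul] at hmono
  unfold timeMean
  rw [abs_mul, abs_of_pos (inv_pos.2 hT)]
  calc T⁻¹ * |∫ τ in (0 : ℝ)..T, P τ| ≤ T⁻¹ * ((T * A + ∫ τ in (0 : ℝ)..T, E τ) / 2) :=
        mul_le_mul_of_nonneg_left (habs.trans hmono) (inv_nonneg.2 hT.le)
    _ = (A + T⁻¹ * ∫ τ in (0 : ℝ)..T, E τ) / 2 := by field_simp

/-- **Cesàro means of smooth pairings along a global Leray–Hopf solution are eventually bounded** (steady smooth mean-zero
force, `ν > 0`; the energy means are bounded by `Torus.IsGlobalLerayHopf.timeMean_norm_sq_le`). -/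
theorem timeMean_pairing_abs_le_eventually (hν : 0 < ν) (hf : IsSmooth f) (hf0 : HasZeroMean f) (hφ : IsSmooth φ)
    (hu : IsGlobalLerayHopf ν (fun _ => f) u₀ u) :
    ∃ B : ℝ, ∀ᶠ T in atTop, |timeMean (fun t => ∫ x, ⟪φ x, u t x⟫) T| ≤ B := by
  refine ⟨((∫ x, ‖φ x‖ ^ 2) + (kineticEnergy u₀ / (2 * Real.pi ^ 2 * ν) +
    (2 * ‖∫ x, u 1 x‖ ^ 2 + (∫ x, ‖f x‖ ^ 2) / (16 * Real.pi ^ 4 * ν ^ 2)))) / 2, ?_⟩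
  filter_upwards [eventually_ge_atTop (1 : ℝ)] with T hT
  have h1 := abs_timeMean_pairing_le hφ hu (lt_of_lt_of_le one_pos hT)
  have h2 := hu.timeMean_norm_sq_le hν hf hf0 hT
  linarith

/-- The four boundedness facts about the Cesàro means of a smooth pairing used below. -/
theorem timeMean_pairing_bounds (hν : 0 < ν) (hf : IsSmooth f) (hf0 : HasZeroMean f) (hφ : IsSmooth φ)
    (hu : IsGlobalLerayHopf ν (fun _ => f) u₀ u) :
    IsBoundedUnder (· ≤ ·) atTop (timeMean (fun t => ∫ x, ⟪φ x, u t x⟫)) ∧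
      IsBoundedUnder (· ≥ ·) atTop (timeMean (fun t => ∫ x, ⟪φ x, u t x⟫)) ∧
      IsCoboundedUnder (· ≤ ·) atTop (timeMean (fun t => ∫ x, ⟪φ x, u t x⟫)) ∧
      IsCoboundedUnder (· ≥ ·) atTop (timeMean (fun t => ∫ x, ⟪φ x, u t x⟫)) := by
  obtain ⟨B, hB⟩ := timeMean_pairing_abs_le_eventually hν hf hf0 hφ hu
  have hle : ∀ᶠ T in atTop, timeMean (fun t => ∫ x, ⟪φ x, u t x⟫) T ≤ B := hB.mono fun T h => (le_abs_self _).trans h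
  have hge : ∀ᶠ T in atTop, -B ≤ timeMean (fun t => ∫ x, ⟪φ x, u t x⟫) T := hB.mono fun T h => (neg_abs_le _).trans' (neg_le_neg h)
  exact ⟨isBoundedUnder_of_eventually_le hle, isBoundedUnder_of_eventually_ge hge,
    isCoboundedUnder_le_of_eventually_le atTop hge, isCoboundedUnder_ge_of_eventually_le atTop hle⟩

/-- Cesàro means commute with constant factors. -/
theorem timeMean_const_mul (c : ℝ) (a : ℝ → ℝ) (T : ℝ) : timeMean (fun t => c * a t) T = c * timeMean a T := by
  unfold timeMean
  rw [intervalIntegral.integral_const_mul]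
  ring

end Means

/-! ## Part 2d: the two costume theorems modulo transposition covariance -/

section Costume

/-- **`S` restricted to the route's force class** (`ZL(𝓕)`): the summit statement with `f = f_{F,G,k,m}`, `k, m ≥ 1`. -/
def ZerothLawTwoMode : Prop :=
  ∃ (F G : ℝ) (k m : ℕ) (ν : ℕ → ℝ) (u₀ : ℕ → 𝕋³ → E³) (u : ℕ → ℝ → 𝕋³ → E³), 0 < k ∧ 0 < m ∧ (∀ j, 0 < ν j) ∧
    Filter.Tendsto ν Filter.atTop (nhds 0) ∧ (∀ j, IsGlobalLerayHopf (ν j) (fun _ => twoModeForce F G k m) (u₀ j) (u j)) ∧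
    (∃ E : ℝ, ∀ j, meanEnergy (u j) ≤ E) ∧ ∃ ε : ℝ, 0 < ε ∧ ∀ j, ε ≤ meanDissipation (ν j) (u j)

/-- `ZL(𝓕) ⇒ S` (specialisation of `∃ f`, force regularity). -/
theorem zerothLawTwoMode_implies_summit (h : ZerothLawTwoMode) : AnomalousDissipation := by
  obtain ⟨F, G, k, m, ν, u₀, u, -, -, hν, hν0, hLH, hE, ε, hε, hfloor⟩ := h
  obtain ⟨hfs, hfd, hf0⟩ := twoModeForce_regular F G k m
  exact ⟨twoModeForce F G k m, hfs, hfd, hf0, ν, u₀, u, hν, hν0, hLH, hE, ε, hε, hfloor⟩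

/-- **Channel split of the mean energy inequality**: for a global Leray–Hopf solution driven by `f_{F,G,k,m}`,
`meanDissipation ≤ ⟨(s_{F,k}, u)⟩_sup + ⟨(g_{G,m}, u)⟩_sup` (dissipation ≤ total power, `limsup` subadditive on bounded means). -/
theorem meanDissipation_le_add_channels {F G : ℝ} {k m : ℕ} {ν : ℝ} (hν : 0 < ν) {u₀ : 𝕋³ → E³} {u : ℝ → 𝕋³ → E³}
    (hu : IsGlobalLerayHopf ν (fun _ => twoModeForce F G k m) u₀ u) :
    meanDissipation ν u ≤ longTimeAvgSup (fun t => ∫ x, ⟪shearField F k x, u t x⟫) +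
      longTimeAvgSup (fun t => ∫ x, ⟪obliqueField G m x, u t x⟫) := by
  obtain ⟨hfs, -, hf0⟩ := twoModeForce_regular F G k m
  have h1 : meanDissipation ν u ≤ meanPower (twoModeForce F G k m) u :=
    DoeringFoias2002_dissipation_le_power_holds hν (hfs.memLp 2) hf0 u₀ u hu
  refine h1.trans ?_
  -- split the total pairing for `t ≥ 0`
  have hsplit : ∀ t, 0 ≤ t → ∫ x, ⟪twoModeForce F G k m x, u t x⟫ =
      (∫ x, ⟪shearField F k x, u t x⟫) + ∫ x, ⟪obliqueField G m x, u t x⟫ := fun t ht => by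
    rw [← integral_add (integrable_inner_of_memLp' ((isSmooth_shearField F k).memLp 2) (hu.memLp_two ht))
      (integrable_inner_of_memLp' ((isSmooth_obliqueField G m).memLp 2) (hu.memLp_two ht))]
    refine integral_congr_ae (ae_of_all _ fun x => ?_)
    show ⟪twoModeForce F G k m x, u t x⟫ = ⟪shearField F k x, u t x⟫ + ⟪obliqueField G m x, u t x⟫
    rw [twoModeForce_apply, inner_add_left]
  -- hence the Cesàro means split for `T > 0`
  set ms : ℝ → ℝ := timeMean (fun t => ∫ x, ⟪shearField F k x, u t x⟫) with hms
  set mo : ℝ → ℝ := timeMean (fun t => ∫ x, ⟪obliqueField G m x, u t x⟫) with hmo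
  have hmeans : ∀ᶠ T in atTop, timeMean (fun t => ∫ x, ⟪twoModeForce F G k m x, u t x⟫) T = (ms + mo) T := by
    filter_upwards [eventually_gt_atTop (0 : ℝ)] with T hT
    have hi : ∫ t in (0 : ℝ)..T, (∫ x, ⟪twoModeForce F G k m x, u t x⟫) =
        ∫ t in (0 : ℝ)..T, ((∫ x, ⟪shearField F k x, u t x⟫) + ∫ x, ⟪obliqueField G m x, u t x⟫) := by
      refine intervalIntegral.integral_congr fun t ht => ?_
      rw [uIcc_of_le hT.le] at ht
      exact hsplit t ht.1
    simp only [Pi.add_apply, hms, hmo, timeMean]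
    rw [hi, intervalIntegral.integral_add (intervalIntegrable_pairing (isSmooth_shearField F k) hu hT)
      (intervalIntegrable_pairing (isSmooth_obliqueField G m) hu hT)]
    ring
  obtain ⟨hs1, hs2, hs3, -⟩ := timeMean_pairing_bounds hν hfs hf0 (isSmooth_shearField F k) hu
  obtain ⟨ho1, -, ho3, -⟩ := timeMean_pairing_bounds hν hfs hf0 (isSmooth_obliqueField G m) hu
  unfold meanPower longTimeAvgSup
  rw [limsup_congr hmeans]
  exact limsup_add_le hs2 hs1 ho3 ho1

/-- Transport of the Leray–Hopf clause under transposition: the transposed family solves the equations for `f_{G,F,m,k}`. -/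
theorem isGlobalLerayHopf_transpose (hT : LerayHopfTransposeCovariance) {F G : ℝ} {k m : ℕ} {ν : ℝ} {U₀ : 𝕋³ → E³}
    {U : ℝ → 𝕋³ → E³} (h : IsGlobalLerayHopf ν (fun _ => twoModeForce F G k m) U₀ U) :
    IsGlobalLerayHopf ν (fun _ => twoModeForce G F m k) (trField U₀) (fun t => trField (U t)) := by
  have h1 := isGlobalLerayHopf_trField hT h
  have e : (fun _ : ℝ => trField (twoModeForce F G k m)) = fun _ => twoModeForce G F m k :=
    funext fun _ => trField_twoModeForce F G k m
  rw [e] at h1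
  exact h1

/-- **`ZL(𝓕) ⇒ C` modulo transposition covariance.**  A dissipation floor `ε` is a floor on the total injection, hence for
each `j` one channel carries `ε/2`; either the oblique channel does so frequently in `j` (subsequence), or the shear channel does
so eventually in `j` — then transpose (`𝒯 f_{F,G,k,m} = f_{G,F,m,k}`, the shear pairing becomes the oblique pairing). -/
theorem zerothLawTwoMode_implies_crux (hT : LerayHopfTransposeCovariance) (h : ZerothLawTwoMode) :
    CriticalLayer.TurbulentCriticalLayersAbsorb := by
  obtain ⟨F, G, k, m, ν, u₀, u, hk, hm, hν, hν0, hLH, ⟨E, hE⟩, ε, hε, hfloor⟩ := h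
  have hsum : ∀ j, ε ≤ longTimeAvgSup (fun t => ∫ x, ⟪shearField F k x, u j t x⟫) +
      longTimeAvgSup (fun t => ∫ x, ⟪obliqueField G m x, u j t x⟫) :=
    fun j => (hfloor j).trans (meanDissipation_le_add_channels (hν j) (hLH j))
  by_cases hA : ∃ N : ℕ, ∀ j, N ≤ j → ε / 2 ≤ longTimeAvgSup (fun t => ∫ x, ⟪shearField F k x, u j t x⟫)
  · -- the shear channel carries `ε/2` eventually: transpose the shifted family
    obtain ⟨N, hN⟩ := hA
    have hfl : ∀ j, ε / 2 ≤ longTimeAvgSup (fun t => ∫ x, ⟪obliqueField F k x, trField (u (j + N) t) x⟫) := fun j => by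
      have e : (fun t => ∫ x, ⟪obliqueField F k x, trField (u (j + N) t) x⟫) = fun t => ∫ x, ⟪shearField F k x, u (j + N) t x⟫ :=
        funext fun t => integral_inner_obliqueField_trField F k (u (j + N) t)
      rw [e]
      exact hN (j + N) (Nat.le_add_left N j)
    exact ⟨G, F, m, k, fun j => ν (j + N), fun j => trField (u₀ (j + N)), fun j t => trField (u (j + N) t), hm, hk,
      fun j => hν _, hν0.comp (tendsto_add_atTop_nat N), fun j => isGlobalLerayHopf_transpose hT (hLH (j + N)),
      ⟨E, fun j => by rw [meanEnergy_trField]; exact hE _⟩, ε / 2, half_pos hε, hfl⟩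
  · -- otherwise the oblique channel carries `ε/2` frequently: pass to a subsequence
    push Not at hA
    have hfreq : ∃ᶠ j in atTop, ε / 2 ≤ longTimeAvgSup (fun t => ∫ x, ⟪obliqueField G m x, u j t x⟫) := by
      rw [frequently_atTop]
      intro N
      obtain ⟨j, hj, hlt⟩ := hA N
      exact ⟨j, hj, by linarith [hsum j]⟩
    obtain ⟨φ, hφ, hφP⟩ := extraction_of_frequently_atTop hfreq
    exact ⟨F, G, k, m, ν ∘ φ, u₀ ∘ φ, u ∘ φ, hk, hm, fun j => hν _, hν0.comp hφ.tendsto_atTop, fun j => hLH _,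
      ⟨E, fun j => hE _⟩, ε / 2, half_pos hε, fun j => hφP j⟩

/-- **VERBATIM the statement of `stub_saturatedKolmogorovFamily`** of the registered birth skeleton
`Cruxes/KolmogorovObliqueThesis/Lines/BirthTurbulentCriticalLayersAbsorb.lean` (piece (i) of the registered split of this crux):
a bounded-energy Leray–Hopf family for `f_{F,G,k,m}`, `F > 0`, `G ≠ 0`, with a liminf floor on the shear-mode amplitude. -/
def SaturatedKolmogorovFamily : Prop :=
  ∃ (F G : ℝ) (k m : ℕ) (ν : ℕ → ℝ) (u₀ : ℕ → 𝕋³ → E³) (u : ℕ → ℝ → 𝕋³ → E³), 0 < F ∧ G ≠ 0 ∧ 0 < k ∧ 0 < m ∧ (∀ j, 0 < ν j) ∧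
    Filter.Tendsto ν Filter.atTop (nhds 0) ∧
    (∀ j, IsGlobalLerayHopf (ν j) (fun _ => (fun x : 𝕋³ => (F * (UnitAddTorus.mFourier (Pi.single (1 : Fin 3) (k : ℤ)) x).im) • (EuclideanSpace.single (0 : Fin 3) (1 : ℝ) : E³) + (G * (UnitAddTorus.mFourier (Pi.single (0 : Fin 3) (m : ℤ)) x).im) • (EuclideanSpace.single (1 : Fin 3) (1 : ℝ) : E³))) (u₀ j) (u j)) ∧
    (∃ E : ℝ, ∀ j, meanEnergy (u j) ≤ E) ∧
    ∃ α : ℝ, 0 < α ∧ ∀ j, α ≤ longTimeAvgInf (fun t => ∫ x, (UnitAddTorus.mFourier (Pi.single (1 : Fin 3) (k : ℤ)) x).im * u j t x 0)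

/-- **Piece (i) of the registered split gives the crux on its own** (modulo transposition covariance): transpose the
family; its oblique injection is `F ×` the old shear-mode amplitude, whose `limsup`-mean dominates its `liminf`-mean `≥ α`
(the Cesàro means are bounded), so the floor is `F α > 0`. -/
theorem saturatedKolmogorovFamily_implies_crux (hT : LerayHopfTransposeCovariance) (h : SaturatedKolmogorovFamily) :
    CriticalLayer.TurbulentCriticalLayersAbsorb := by
  obtain ⟨F, G, k, m, ν, u₀, u, hF, -, hk, hm, hν, hν0, hLH, ⟨E, hE⟩, α, hα, hfloor⟩ := h
  have hLH' : ∀ j, IsGlobalLerayHopf (ν j) (fun _ => twoModeForce F G k m) (u₀ j) (u j) := hLH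
  obtain ⟨hfs, -, hf0⟩ := twoModeForce_regular F G k m
  have hfl : ∀ j, F * α ≤ longTimeAvgSup (fun t => ∫ x, ⟪obliqueField F k x, trField (u j t) x⟫) := fun j => by
    -- the oblique pairing of the transposed field is `F ×` the shear amplitude
    have e : (fun t => ∫ x, ⟪obliqueField F k x, trField (u j t) x⟫) = fun t => F * shearAmp k (u j t) :=
      funext fun t => by rw [integral_inner_obliqueField_trField, integral_inner_shearField]
    rw [e]
    -- the unit shear pairing has bounded Cesàro means, and equals the shear amplitude
    have e1 : (fun t => ∫ x, ⟪shearField 1 k x, u j t x⟫) = fun t => shearAmp k (u j t) :=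
      funext fun t => by rw [integral_inner_shearField, one_mul]
    obtain ⟨hb1, hb2, hb3, -⟩ := timeMean_pairing_bounds (hν j) hfs hf0 (isSmooth_shearField 1 k) (hLH' j)
    rw [e1] at hb1 hb2 hb3
    have e2 : timeMean (fun t => F * shearAmp k (u j t)) = (fun y => F * y) ∘ timeMean (fun t => shearAmp k (u j t)) :=
      funext fun T => timeMean_const_mul F (fun t => shearAmp k (u j t)) T
    have hmono : Monotone fun y : ℝ => F * y := fun a b hab => mul_le_mul_of_nonneg_left hab hF.le
    have hcont : Continuous fun y : ℝ => F * y := continuous_const.mul continuous_id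
    unfold longTimeAvgSup
    rw [e2, ← hmono.map_limsup_of_continuousAt _ hcont.continuousAt hb1 hb3]
    have hli : liminf (timeMean (fun t => shearAmp k (u j t))) atTop ≤ limsup (timeMean (fun t => shearAmp k (u j t))) atTop :=
      liminf_le_limsup hb1 hb2
    have hα' : α ≤ liminf (timeMean (fun t => shearAmp k (u j t))) atTop := hfloor j
    exact (mul_le_mul_of_nonneg_left (hα'.trans hli) hF.le)
  exact ⟨G, F, m, k, ν, fun j => trField (u₀ j), fun j t => trField (u j t), hm, hk, hν, hν0,
    fun j => isGlobalLerayHopf_transpose hT (hLH' j), ⟨E, fun j => by rw [meanEnergy_trField]; exact hE _⟩,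
    F * α, mul_pos hF hα, hfl⟩

end Costume


end Summit.AnomalousDissipation.AnomalousDissipation.Cruxes.TurbulentCriticalLayersAbsorb

end
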